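import Literature.ModelTheory.FiniteModelTheory.CohomologicalConsistency
import Mathlib.Algebra.BigOperators.Ring.Finset
import Mathlib.Data.Int.Cast.Lemmas
import Mathlib.Data.Finset.Image
import Mathlib.Data.Fintype.Basic
import HarnessLib

/-!
# Cohomological `k`-consistency decides linear equations over rings (Ó Conghaile 2022, Thm 9 / 26)

Source: A. Ó Conghaile, *Cohomology in Constraint Satisfaction and Structure Isomorphism*,
MFCS 2022, LIPIcs 241, 75:1–75:16 = arXiv:2206.15253 (numbering of the arXiv version): §5.1,
Theorem 9 ("thm:rings"), and its appendix form Theorem 26 (Appendix "Proof of Theorem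
(thm:rings)") with its proof, which invokes Abramsky–Barbosa–Kishida–Lal–Mansfield,
*Contextuality, Cohomology and Paradox* (CSL 2015, LIPIcs 41 = arXiv:1502.03097), §4.3 (affine
closures) and Theorem 6.1
(`AvN_R ⟹ SC(Aff) ⟹ CSC_R ⟹ CSC_ℤ`), quoted by Ó Conghaile as Theorems 24 and 25.

## The mathematics

A structure `B` over a relational signature has a RING REPRESENTATION (§5.1) if its universe carries
a ring structure for which every relation `R^B ⊆ B^m` is affine,
`R^B = {x | ∑_i b_i · x_i = a}`; an instance `A` of `CSP(B)` is then a system of linear equations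
over that ring (the related tuples of `A` are the equations), and `A → B` iff the system is
solvable.
THEOREM 9 / 26: there is a `k` (the proof gives: any `k ≥` the maximal arity `n` of the signature)
such that for all `A`, `A →^ℤ_k B ⟺ A → B`.

PROOF (Appendix, proof of Thm 26, made explicit).  `⟸` is `CohomologicallyKConsistent.of_hom`.
`⟹`: a witness of `A →^ℤ_k B` contains a section `s₀ ∈ Hom_k(A,B)(U₀)` that is `ℤ`-extendable
inside `Hom_k(A,B)`, i.e. a compatible family `r_U ∈ ℤ[Hom_k(A,B)(U)]`, `|U| ≤ k`, with
`r_{U₀} = 1·s₀`.  Compatibility with `∅` shows every `r_U` has total mass `1`, so `r` is a global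
section of the AFFINE CLOSURE and (this is the content of ABKLM's `AvN_R ⟹ CSC`) its pointwise
average `g(a) := ∑_u r_{{a}}(u) · u(a) ∈ B` is a global assignment satisfying the whole `R`-linear
theory of `Hom_k(A,B)`: for an equation `∑ b_i x_i = a` of `A` on variables `V` (`|V| ≤ n ≤ k`),
`∑_i b_i g(x_i) = ∑_t r_V(t) (∑_i b_i t(x_i)) = (∑_t r_V(t)) · a = a`, because every `t` in the
support of `r_V` is a partial homomorphism on `V ⊇ {x_i}`.  Hence `g : A → B` is a homomorphism.
(As the source remarks after Thm 26, one round of the algorithm — indeed one `ℤ`-extendable section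
of `𝓗_k(A,B)` — suffices: `nonempty_hom_of_zExt_homSystem`.)

## Lean rendering

* `IsRingRepresentation L B` (given `[Ring B]`): every `RelMap r` is the solution set of one
  `B`-linear equation; `HasRingRepresentation L B := ∃ ring structure, IsRingRepresentation` is the
  wording of Theorem 9.  The signature must be relational (`[L.IsRelational]`, as in the source) for
  a map preserving relations to be a Mathlib homomorphism `A →[L] B`.
* `linEqLanguage R n` is the signature `σ_R^{≤n} ⊆ σ_R` of §5.1 (one `m`-ary symbol `E^m_{c,b}` for
  each `m ≤ n`, `c ∈ R^m`, `b ∈ R`) with `R` as the template structure `linEqLanguage.template`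
  (`RelMap E^m_{c,b} x ↔ ∑ c_i x_i = b`); an `L`-structure `A` is a system of `R`-linear equations
  with `≤ n` variables per equation and `A → R` is a solution.
* Main results: `nonempty_hom_of_zExt_homSystem` (one `ℤ`-extendable section suffices),
  `cohomologicallyKConsistent_iff_nonempty_hom` (Thm 26 with the explicit level `k ≥ n`),
  `HasRingRepresentation.exists_level` (Thm 9 as printed), `linEq_cohomologicallyKConsistent_iff`
  and `OConghaile2022_rings` (Thm 26 for `σ_R^{≤n}`, as printed: `∃ k`).  Finiteness of `R`, `A`
  and of the signature (assumed in the source) is not needed and not assumed; only bounded arity.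

What is NOT here: the strictness examples (`A_k →_k B`, `A_k ↛ B`, Feder–Vardi) and the
consequences for FPC / rank logic drawn in §5.
-/

namespace Literature.ModelTheory.FiniteModelTheory

open FirstOrder FirstOrder.Language FirstOrder.Language.Structure
open scoped BigOperators

universe u v u' v'

/-! ### Affine averages of `ℤ`-linear sections -/

namespace SectionSystem

variable {A : Type u} {B : Type v}

/-- The TOTAL MASS `∑_t r(t)` of a formal `ℤ`-combination of sections. [folklore] -/
def mass {U : Finset A} (f : (↥U → B) →₀ ℤ) : ℤ :=
  f.sum fun _ z => z

/-- Restriction of formal sums preserves the total mass. [folklore] -/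
theorem mass_mapDomain {D U : Finset A} (h : D ⊆ U) (f : (↥U → B) →₀ ℤ) :
    mass (Finsupp.mapDomain (SectionSystem.restrict h) f) = mass f :=
  Finsupp.sum_mapDomain_index (fun _ => rfl) (fun _ _ _ => rfl)

/-- `mass (1·s) = 1`. [folklore] -/
theorem mass_single {U : Finset A} (s : ↥U → B) : mass (Finsupp.single s (1 : ℤ)) = 1 :=
  Finsupp.sum_single_index rfl

variable {k : ℕ} {S : SectionSystem A B} {r : ZSections A B}

/-- All components `r_U`, `|U| ≤ k`, of a `ℤ`-linear global section have the same mass as `r_∅`.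
[cite: AbramskyBarbosaKishidaLalMansfield2015, §4.3 and proof of Thm 6.1] -/
theorem IsZLinearSection.mass_eq (hr : IsZLinearSection k S r) {U : Finset A} (hU : U.card ≤ k) :
    mass (r U) = mass (r ∅) := by
  rw [← hr.2 (Finset.empty_subset U) hU, mass_mapDomain]

/-- A `ℤ`-linear global section through `1·s₀` has mass `1` on every context: it is a global
section of the affine closure ("all these `r_C` must be formal affine combinations").
[cite: AbramskyBarbosaKishidaLalMansfield2015, proof of Thm 6.1] -/
theorem IsZLinearSection.mass_eq_one (hr : IsZLinearSection k S r) {U₀ : Finset A}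
    {s₀ : ↥U₀ → B} (hU₀ : U₀.card ≤ k) (h₀ : r U₀ = Finsupp.single s₀ 1) {U : Finset A}
    (hU : U.card ≤ k) : mass (r U) = 1 := by
  rw [hr.mass_eq hU, ← hr.mass_eq hU₀, h₀, mass_single]

variable [Ring B]

/-- The AFFINE AVERAGE of a family of formal `ℤ`-combinations of sections: the global assignment
`g(a) := ∑_u r_{{a}}(u) · u(a)` (the counit / evaluation map `ε : F_ℤ U 𝓔 → 𝓔` applied to the
affine combination `r_{{a}}`, glued over the singleton contexts).
[cite: AbramskyBarbosaKishidaLalMansfield2015, §6 (proof of Thm 6.1)] -/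
def affineAverage (r : ZSections A B) (a : A) : B :=
  (r {a}).sum fun u z => (z : B) * u ⟨a, Finset.mem_singleton_self a⟩

/-- On a context `V ∋ a` with `|V| ≤ k` the affine average is computed by `r_V`:
`g(a) = ∑_t r_V(t) · t(a)` (naturality of the evaluation map).
[cite: AbramskyBarbosaKishidaLalMansfield2015, §6 (proof of Thm 6.1)] -/
theorem IsZLinearSection.affineAverage_eq (hr : IsZLinearSection k S r) {V : Finset A}
    (hV : V.card ≤ k) {a : A} (ha : a ∈ V) :
    affineAverage r a = (r V).sum fun t z => (z : B) * t ⟨a, ha⟩ := by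
  have hsub : ({a} : Finset A) ⊆ V := Finset.singleton_subset_iff.2 ha
  unfold affineAverage
  rw [← hr.2 hsub hV, Finsupp.sum_mapDomain_index (fun _ => by simp)
    (fun _ _ _ => by simp [add_mul])]
  rfl

/-- THE AFFINE-COMBINATION STEP: if every section `t` in the support of a mass-one formal sum
`f = ∑ z_t t` over `V` satisfies the linear equation `∑_i b_i · t(x_i) = a`, then so does the
average: `∑_i b_i · (∑_t z_t t(x_i)) = a` ("an affine combination of solutions is again a
solution"). [cite: AbramskyBarbosaKishidaLalMansfield2015, §4.3] -/
theorem linear_eq_of_forall_support {V : Finset A} {m : ℕ} (f : (↥V → B) →₀ ℤ)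
    (hf : mass f = 1) (b : Fin m → B) (a : B) (x : Fin m → ↥V)
    (h : ∀ t, f t ≠ 0 → ∑ i, b i * t (x i) = a) :
    ∑ i, b i * (f.sum fun t z => (z : B) * t (x i)) = a := by
  have hmass : ∑ t ∈ f.support, (f t : B) = 1 := by
    have := congrArg (fun z : ℤ => (z : B)) hf
    simpa [mass, Finsupp.sum] using this
  calc ∑ i, b i * (f.sum fun t z => (z : B) * t (x i))
      = ∑ i, ∑ t ∈ f.support, (f t : B) * (b i * t (x i)) := by
        refine Finset.sum_congr rfl fun i _ => ?_
        rw [Finsupp.sum, Finset.mul_sum]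
        exact Finset.sum_congr rfl fun t _ => (Int.commute_cast (b i) (f t)).left_comm (t (x i))
    _ = ∑ t ∈ f.support, (f t : B) * ∑ i, b i * t (x i) := by
        rw [Finset.sum_comm]
        exact Finset.sum_congr rfl fun t _ => (Finset.mul_sum _ _ _).symm
    _ = ∑ t ∈ f.support, (f t : B) * a :=
        Finset.sum_congr rfl fun t ht => by rw [h t (Finsupp.mem_support_iff.1 ht)]
    _ = a := by rw [← Finset.sum_mul, hmass, one_mul]

end SectionSystem

/-! ### Ring representations and Theorem 26 -/

section Structures

/-- `B` IS A RING REPRESENTATION (for the given ring structure on its universe): every relation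
`R^B ⊆ B^m` is an affine subset, `R^B = {x | ∑_i b_i · x_i = a}` for some `b ∈ B^m`, `a ∈ B`.
For `B = R` this is "`R` represented as a relational structure over `σ ⊆ σ_R`" (relation symbols
`E^m_{b,a}`). [cite: OConghaile2022, §5.1] -/
def IsRingRepresentation (L : Language.{u', v'}) (B : Type v) [L.Structure B] [Ring B] : Prop :=
  ∀ ⦃m : ℕ⦄ (r : L.Relations m), ∃ (b : Fin m → B) (a : B), ∀ x : Fin m → B,
    RelMap r x ↔ ∑ i, b i * x i = a

/-- `B` HAS A RING REPRESENTATION: its universe can be given a ring structure making every relation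
affine (the hypothesis of Theorem 9 as printed). [cite: OConghaile2022, §5.1] -/
def HasRingRepresentation (L : Language.{u', v'}) (B : Type v) [L.Structure B] : Prop :=
  ∃ _i : Ring B, IsRingRepresentation L B

variable {L : Language.{u', v'}} {B : Type v} [L.Structure B]

/-- ONE `ℤ`-EXTENDABLE SECTION SUFFICES (the proof of Theorem 26, via ABKLM's `AvN_R ⟹ CSC_ℤ`): over
a relational signature all of whose symbols have arity `≤ k`, if `B` is a ring representation and
some `k`-local homomorphism `s₀` is `ℤ`-extendable inside a subfamily `S ⊆ 𝓗_k(A,B)`, then the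
affine average of the extending `ℤ`-linear section is a homomorphism `A → B`.
[cite: OConghaile2022, Thm 26 (proof, Appendix)] -/
theorem nonempty_hom_of_zExt [Ring B] [L.IsRelational] {k : ℕ} (hB : IsRingRepresentation L B)
    (hk : ∀ ⦃m : ℕ⦄, L.Relations m → m ≤ k) {A : Type u} [L.Structure A]
    {S : SectionSystem A B} (hS : S ≤ homSystem L k A B) {U₀ : Finset A} {s₀ : ↥U₀ → B}
    (hs₀ : s₀ ∈ S U₀) (hz : S.ZExt k U₀ s₀) : Nonempty (A →[L] B) := by
  classical
  obtain ⟨r, hr, h₀⟩ := hz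
  have hU₀ : U₀.card ≤ k := (hS _ hs₀).1
  refine ⟨{ toFun := SectionSystem.affineAverage r
            map_fun' := fun f => isEmptyElim f
            map_rel' := ?_ }⟩
  intro m rel x hx
  obtain ⟨b, a, hba⟩ := hB rel
  -- the context of the equation: the set of its variables
  let V : Finset A := Finset.univ.image x
  have hVk : V.card ≤ k :=
    (Finset.card_image_le.trans (by simp)).trans (hk rel)
  let x' : Fin m → ↥V := fun i => ⟨x i, Finset.mem_image_of_mem x (Finset.mem_univ i)⟩
  -- every section in the support of `r_V` is a partial homomorphism on `V`, so solves the equation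
  have hsol : ∀ t, r V t ≠ 0 → ∑ i, b i * t (x' i) = a := fun t ht =>
    (hba _).1 ((hS _ (hr.1 V t ht)).2 rel x' hx)
  -- the affine average is computed on `V` and is an affine combination of solutions
  rw [hba]
  have hg : ∀ i, SectionSystem.affineAverage r (x i) =
      (r V).sum fun t z => (z : B) * t (x' i) := fun i =>
    hr.affineAverage_eq hVk (x' i).2
  simp only [Function.comp_apply, hg]
  exact SectionSystem.linear_eq_of_forall_support (r V) (hr.mass_eq_one hU₀ h₀ hVk) b a x' hsol

/-- The same for `𝓗_k(A,B)` itself: if some `k`-local homomorphism is `ℤ`-extendable inside the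
full presheaf `𝓗_k(A,B)` (no fixpoint iteration), then `A → B` — "the algorithm decides these
systems after just one iteration of its loop".
[cite: OConghaile2022, Appendix, remark after the proof of Thm 26] -/
theorem nonempty_hom_of_zExt_homSystem [Ring B] [L.IsRelational] {k : ℕ}
    (hB : IsRingRepresentation L B) (hk : ∀ ⦃m : ℕ⦄, L.Relations m → m ≤ k) {A : Type u}
    [L.Structure A] {U₀ : Finset A} {s₀ : ↥U₀ → B} (hs₀ : s₀ ∈ homSystem L k A B U₀)
    (hz : (homSystem L k A B).ZExt k U₀ s₀) : Nonempty (A →[L] B) :=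
  nonempty_hom_of_zExt hB hk le_rfl hs₀ hz

/-- THEOREM 26 with the explicit level: over a relational signature of maximal arity `≤ k`, for a
ring representation `B` (any ring structure on the universe making all relations affine) and every
instance `A`: `A →^ℤ_k B ⟺ A → B`.  The source assumes `B`, `A` and the signature finite; none of
this is needed. [cite: OConghaile2022, Thm 26] -/
theorem cohomologicallyKConsistent_iff_nonempty_hom [Ring B] [L.IsRelational] {k : ℕ}
    (hB : IsRingRepresentation L B) (hk : ∀ ⦃m : ℕ⦄, L.Relations m → m ≤ k) (A : Type u)
    [L.Structure A] [DecidableEq A] :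
    CohomologicallyKConsistent L k A B ↔ Nonempty (A →[L] B) := by
  refine ⟨fun h => ?_, fun ⟨f⟩ => CohomologicallyKConsistent.of_hom f⟩
  obtain ⟨S, hS, ⟨U₀, s₀, hs₀⟩, hz⟩ := (cohomologicallyKConsistent_iff_zext L k A B).1 h
  exact nonempty_hom_of_zExt hB hk hS hs₀ (hz hs₀)

/-- THEOREM 9 as printed: for any structure `B` with a ring representation (over a relational
signature of bounded arity — automatic for the finite signatures of the source) there is a `k` such
that the cohomological `k`-consistency algorithm decides `CSP(B)`: for all `A`,
`A →^ℤ_k B ⟺ A → B`. [cite: OConghaile2022, Thm 9] -/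
theorem HasRingRepresentation.exists_level [L.IsRelational] (hB : HasRingRepresentation L B)
    {n : ℕ} (hn : ∀ ⦃m : ℕ⦄, L.Relations m → m ≤ n) :
    ∃ k : ℕ, ∀ (A : Type u) [L.Structure A] [DecidableEq A],
      CohomologicallyKConsistent L k A B ↔ Nonempty (A →[L] B) := by
  obtain ⟨_i, hB⟩ := hB
  exact ⟨n, fun A _ _ => cohomologicallyKConsistent_iff_nonempty_hom hB hn A⟩

end Structures

/-! ### Systems of linear equations over a ring `R` as relational structures (`σ_R`) -/

section LinEq

/-- The signature `σ_R^{≤n} ⊆ σ_R` of SYSTEMS OF `R`-LINEAR EQUATIONS WITH AT MOST `n` VARIABLES PER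
EQUATION: for every arity `m ≤ n`, one relation symbol `E^m_{c,b}` for each coefficient vector
`c ∈ R^m` and right-hand side `b ∈ R`; no symbols of arity `> n`; no function symbols.  (`σ_R` is
the union over all `n`; a finite `σ ⊆ σ_R` as in the source lies in some `σ_R^{≤n}`, and for finite
`R` each `σ_R^{≤n}` is finite.) [cite: OConghaile2022, §5.1] -/
def linEqLanguage (R : Type v) (n : ℕ) : Language.{0, v} where
  Functions := fun _ => Empty
  Relations := fun m => {_p : (Fin m → R) × R // m ≤ n}

/-- `σ_R^{≤n}` is relational. [cite: OConghaile2022, §5.1] -/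
instance linEqLanguage.isRelational (R : Type v) (n : ℕ) : (linEqLanguage R n).IsRelational :=
  fun _ => inferInstanceAs (IsEmpty Empty)

/-- THE TEMPLATE: the ring `R` as a `σ_R^{≤n}`-structure, `E^m_{c,b}` interpreted as the solution
set `{x ∈ R^m | ∑_i c_i · x_i = b}`.  An arbitrary `σ_R^{≤n}`-structure `A` is a system of
`R`-linear equations (variables = elements of `A`, one equation `∑ c_i x_i = b` per related tuple
`x ∈ (E^m_{c,b})^A`), and homomorphisms `A → R` are exactly its solutions.
[cite: OConghaile2022, §5.1] -/
instance linEqLanguage.template (R : Type v) [Ring R] (n : ℕ) :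
    (linEqLanguage R n).Structure R where
  funMap := fun f => Empty.elim f
  RelMap := fun r x => ∑ i, r.1.1 i * x i = r.1.2

/-- Unfolding the template interpretation. [cite: OConghaile2022, §5.1] -/
@[simp] theorem linEqLanguage.relMap_iff {R : Type v} [Ring R] {n m : ℕ}
    (r : (linEqLanguage R n).Relations m) (x : Fin m → R) :
    RelMap r x ↔ ∑ i, r.1.1 i * x i = r.1.2 := Iff.rfl

/-- The template `R` over `σ_R^{≤n}` is a ring representation. [cite: OConghaile2022, §5.1] -/
theorem linEqLanguage.isRingRepresentation (R : Type v) [Ring R] (n : ℕ) :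
    IsRingRepresentation (linEqLanguage R n) R :=
  fun _ r => ⟨r.1.1, r.1.2, fun _ => Iff.rfl⟩

/-- All symbols of `σ_R^{≤n}` have arity `≤ n`. [cite: OConghaile2022, §5.1] -/
theorem linEqLanguage.arity_le {R : Type v} {n m : ℕ} (r : (linEqLanguage R n).Relations m) :
    m ≤ n := r.2

/-- THEOREM 26 for systems of linear equations, explicit level: for every ring `R`, arity bound `n`
and `k ≥ n`, a system `A` of `R`-linear equations with `≤ n` variables per equation is solvable iff
it is cohomologically `k`-consistent with respect to the template `R`:
`A →^ℤ_k R ⟺ A → R`. [cite: OConghaile2022, Thm 26] -/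
theorem linEq_cohomologicallyKConsistent_iff (R : Type v) [Ring R] {n k : ℕ} (hk : n ≤ k)
    (A : Type u) [(linEqLanguage R n).Structure A] [DecidableEq A] :
    CohomologicallyKConsistent (linEqLanguage R n) k A R ↔ Nonempty (A →[linEqLanguage R n] R) :=
  cohomologicallyKConsistent_iff_nonempty_hom (linEqLanguage.isRingRepresentation R n)
    (fun _ r => (linEqLanguage.arity_le r).trans hk) A

/-- THEOREM 26 AS PRINTED ("thm:rings"): for any ring `R` represented as a relational structure
over `σ_R^{≤n}` there is a `k` such that the cohomological `k`-consistency algorithm decides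
`CSP(R)`, i.e. for all `σ_R^{≤n}`-structures `A`, `A →^ℤ_k R ⟺ A → R`.  (Source: `R` finite; not
needed.) [cite: OConghaile2022, Thm 26] -/
theorem OConghaile2022_rings (R : Type v) [Ring R] (n : ℕ) :
    ∃ k : ℕ, ∀ (A : Type u) [(linEqLanguage R n).Structure A] [DecidableEq A],
      CohomologicallyKConsistent (linEqLanguage R n) k A R ↔
        Nonempty (A →[linEqLanguage R n] R) :=
  ⟨n, fun A _ _ => linEq_cohomologicallyKConsistent_iff R le_rfl A⟩

/-- In particular (with `CohomologicallyKConsistent.kConsistent`): at such a level, every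
UNSOLVABLE system is rejected by cohomological `k`-consistency — whereas plain `k`-consistency
accepts unsolvable systems over every non-trivial finite ring for every `k` (Feder–Vardi; not
formalised here). [cite: OConghaile2022, §5.1 (discussion after Thm 9)] -/
theorem not_cohomologicallyKConsistent_of_isEmpty_hom (R : Type v) [Ring R] {n k : ℕ} (hk : n ≤ k)
    (A : Type u) [(linEqLanguage R n).Structure A] [DecidableEq A]
    (hA : IsEmpty (A →[linEqLanguage R n] R)) :
    ¬ CohomologicallyKConsistent (linEqLanguage R n) k A R := fun h =>
  hA.false ((linEq_cohomologicallyKConsistent_iff R hk A).1 h).some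

end LinEq

end Literature.ModelTheory.FiniteModelTheory
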